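import Summits.Ventures.CertifiedArithmetic.Statement
import Summits.Ventures.CertifiedArithmetic.LowPrec.ScaleInvariance
import Summits.Ventures.CertifiedArithmetic.LowPrec.SignificandErrorValue
import Summits.Ventures.CertifiedArithmetic.LowPrec.PatternEnvelopeMulModes
import Summits.Ventures.CertifiedArithmetic.LowPrec.PatternEnvelopeAddModes
import Summits.Ventures.CertifiedArithmetic.LowPrec.PatternBandsUlp

/-!
# Enum-seat rung statements beyond `Statement.lean` (R1, scale invariance; significand-level error formulas; the whole-range and per-band table constants — relative, ulp, absolute — as proved algorithms)

HONEST FRAMING (venture CertifiedArithmetic / cell `pub-lowprec`): certified error envelopes and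
provably optimal rounding/accumulation schemes for low-precision formats under stated cost models;
every table by two implementations; no hardware or vendor claims.

`Summits/Ventures/CertifiedArithmetic/Statement.lean` carries the venture statement verbatim and the
rung Props R1–R4; it has reached the 400-line size limit of the gate, so further theorem-shaped rung
targets of the enumeration seat are stated HERE, in the same namespace and style (a `Prop`
quantifying over all data of every format, docstring naming the landed proof), each followed by its
`_holds` theorem. Nothing here is a `True`/vacuous definition.
-/

namespace Summit.Ventures.CertifiedArithmetic

open Literature.ComputerArithmetic.FloatingPoint
open Literature.ComputerArithmetic.FloatingPoint.MiniFloat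
open Literature.ComputerArithmetic.FloatingPoint.Format

/-! ### R1 — envelopes (continued) -/

/-- R1 (SCALE INVARIANCE on the normal range, every format, every rounding of the tables): for
`2^m·quantum ≤ |x|` and `|2^k x| ≤ maxRat`, `fl(2^k x) = 2^k fl(x)` under RNE, RZ, RD and RU — so
the rounding error of `n·2^e·quantum` relative to `|x|` (or in ulps) depends on the pattern `n`
only, not on the binade `e` (THEOREMS-R1 Theorem E5, core step; the reduction of a table's
normal-band envelope constants to finitely many significand patterns).
PROVED: `MiniFloat.toRat_roundNE_two_pow_mul`, `MiniFloat.toRat_roundTowardZero_two_pow_mul`,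
`MiniFloat.toRat_roundDown_two_pow_mul`, `MiniFloat.toRat_roundUp_two_pow_mul`
(ScaleInvariance.lean). -/
def R1_ScaleInvariance (φ : Format) : Prop :=
  ∀ (k : ℕ) (x : ℚ), 2 ^ φ.manBits * φ.quantum ≤ |x| → |2 ^ k * x| ≤ φ.maxRat →
    (roundNE φ (2 ^ k * x)).toRat = 2 ^ k * (roundNE φ x).toRat ∧
    (roundTowardZero φ (2 ^ k * x)).toRat = 2 ^ k * (roundTowardZero φ x).toRat ∧
    (roundDown φ (2 ^ k * x)).toRat = 2 ^ k * (roundDown φ x).toRat ∧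
    (roundUp φ (2 ^ k * x)).toRat = 2 ^ k * (roundUp φ x).toRat

/-- R1 scale invariance: PROVED for every format. -/
theorem R1_ScaleInvariance_holds (φ : Format) : R1_ScaleInvariance φ :=
  fun k _ hlo hhi =>
    ⟨toRat_roundNE_two_pow_mul k hlo hhi, toRat_roundTowardZero_two_pow_mul k hlo hhi,
      toRat_roundDown_two_pow_mul k hlo hhi, toRat_roundUp_two_pow_mul k hlo hhi⟩

/-- R1 (RELATIVE ERROR IS A FUNCTION OF THE SIGNIFICAND PATTERN, RNE): on the normal range the
relative rounding error at `2^k x` equals the one at `x`, every format.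
PROVED: `MiniFloat.relErr_roundNE_two_pow_mul` (ScaleInvariance.lean). -/
def R1_RelErrBinadeFree (φ : Format) : Prop :=
  ∀ (k : ℕ) (x : ℚ), 2 ^ φ.manBits * φ.quantum ≤ |x| → |2 ^ k * x| ≤ φ.maxRat →
    |2 ^ k * x - (roundNE φ (2 ^ k * x)).toRat| / |2 ^ k * x| = |x - (roundNE φ x).toRat| / |x|

/-- R1 binade-free relative error (RNE): PROVED for every format. -/
theorem R1_RelErrBinadeFree_holds (φ : Format) : R1_RelErrBinadeFree φ :=
  fun k _ hlo hhi => (relErr_roundNE_two_pow_mul k hlo hhi).1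

/-- R1 (SIGNIFICAND-LEVEL ERROR FORMULAS, every format; THEOREMS-R1 Theorem E5 in closed form):
if `|x| = n·2^s/2^k·quantum ≤ maxRat` with `n` a `(manBits + 1 + k)`-bit pattern
(`2^(manBits+k) ≤ n < 2^(manBits+k+1)`) and `rem = n mod 2^k`, then the absolute rounding errors
are `min(rem, 2^k − rem)·2^s/2^k·quantum` under RNE and `rem·2^s/2^k·quantum` under RZ, the RD
error of a non-negative `x` is the RZ one and the RU error of a positive `x` is
`(2^k − rem)·2^s/2^k·quantum` (`0` when `rem = 0`); consequently the error relative to `|x|` is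
`err(n)/n` — a function of the pattern alone, the binade `s` and the top binade included — and
`x` is an RNE value (equivalently an RZ value) iff `2^k ∣ n`. The table constant of Theorem E5 is
therefore the maximum of the explicit rational `err(n)/n` over the realisable placeable patterns.
PROVED: `MiniFloat.abs_sub_roundNE_of_pattern`, `MiniFloat.abs_sub_roundTowardZero_of_pattern`,
`MiniFloat.sub_roundDown_of_pattern`, `MiniFloat.roundUp_sub_of_pattern`,
`MiniFloat.relErr_roundNE_of_pattern`, `MiniFloat.relErr_roundTowardZero_of_pattern`,
`MiniFloat.toRat_roundNE_eq_self_iff_of_pattern`,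
`MiniFloat.toRat_roundTowardZero_eq_self_iff_of_pattern` (SignificandErrorValue.lean, on top of the
grid-level `Format.rneGrid_of_pattern` / `rdGrid_of_pattern` / `ruGrid_of_pattern`,
SignificandError.lean). -/
def R1_SignificandErrorFormula (φ : Format) : Prop :=
  ∀ (n k s : ℕ) (x : ℚ), 2 ^ (φ.manBits + k) ≤ n → n < 2 ^ (φ.manBits + k + 1) →
    |x| = (n : ℚ) * 2 ^ s / 2 ^ k * φ.quantum → |x| ≤ φ.maxRat →
    |x - (roundNE φ x).toRat|
        = ((min (n % 2 ^ k) (2 ^ k - n % 2 ^ k) : ℕ) : ℚ) * 2 ^ s / 2 ^ k * φ.quantum ∧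
    |x - (roundTowardZero φ x).toRat| = ((n % 2 ^ k : ℕ) : ℚ) * 2 ^ s / 2 ^ k * φ.quantum ∧
    (0 ≤ x → x - (roundDown φ x).toRat = ((n % 2 ^ k : ℕ) : ℚ) * 2 ^ s / 2 ^ k * φ.quantum) ∧
    (0 < x → (roundUp φ x).toRat - x
        = ((if n % 2 ^ k = 0 then 0 else 2 ^ k - n % 2 ^ k : ℕ) : ℚ) * 2 ^ s / 2 ^ k
            * φ.quantum) ∧
    |x - (roundNE φ x).toRat| / |x| = ((min (n % 2 ^ k) (2 ^ k - n % 2 ^ k) : ℕ) : ℚ) / n ∧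
    |x - (roundTowardZero φ x).toRat| / |x| = ((n % 2 ^ k : ℕ) : ℚ) / n ∧
    ((roundNE φ x).toRat = x ↔ 2 ^ k ∣ n) ∧ ((roundTowardZero φ x).toRat = x ↔ 2 ^ k ∣ n)

/-- R1 significand-level error formulas: PROVED for every format. -/
theorem R1_SignificandErrorFormula_holds (φ : Format) : R1_SignificandErrorFormula φ :=
  fun _ _ _ _ hlo hhi hx hmax =>
    ⟨abs_sub_roundNE_of_pattern hlo hhi hx hmax, abs_sub_roundTowardZero_of_pattern hlo hhi hx hmax,
      fun hx0 => sub_roundDown_of_pattern hx0 hlo hhi hx hmax,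
      fun hx0 => roundUp_sub_of_pattern hx0 hlo hhi hx hmax,
      relErr_roundNE_of_pattern hlo hhi hx hmax, relErr_roundTowardZero_of_pattern hlo hhi hx hmax,
      toRat_roundNE_eq_self_iff_of_pattern hlo hhi hx hmax,
      toRat_roundTowardZero_eq_self_iff_of_pattern hlo hhi hx hmax⟩

/-- R1 (RELATIVE ERROR IS BINADE-FREE, explicit form, RNE and RZ): the same pattern `n` placed in
two binades `s`, `s'` (both within range) has the same relative rounding error, every format.
PROVED: `MiniFloat.relErr_roundNE_eq_of_pattern`, `MiniFloat.relErr_roundTowardZero_eq_of_pattern`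
(SignificandErrorValue.lean). -/
def R1_RelErrPatternOnly (φ : Format) : Prop :=
  ∀ (n k s s' : ℕ) (x x' : ℚ), 2 ^ (φ.manBits + k) ≤ n → n < 2 ^ (φ.manBits + k + 1) →
    |x| = (n : ℚ) * 2 ^ s / 2 ^ k * φ.quantum → |x'| = (n : ℚ) * 2 ^ s' / 2 ^ k * φ.quantum →
    |x| ≤ φ.maxRat → |x'| ≤ φ.maxRat →
    |x - (roundNE φ x).toRat| / |x| = |x' - (roundNE φ x').toRat| / |x'| ∧
    |x - (roundTowardZero φ x).toRat| / |x|
      = |x' - (roundTowardZero φ x').toRat| / |x'|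

/-- R1 pattern-only relative error: PROVED for every format. -/
theorem R1_RelErrPatternOnly_holds (φ : Format) : R1_RelErrPatternOnly φ :=
  fun _ _ _ _ _ _ hlo hhi hx hx' hmax hmax' =>
    ⟨relErr_roundNE_eq_of_pattern hlo hhi hx hx' hmax hmax',
      relErr_roundTowardZero_eq_of_pattern hlo hhi hx hx' hmax hmax'⟩


/-! ### Appended 2026-08-20 (enum g8): the table constants are a proved algorithm -/

/-- R1 (THE PRODUCT-TABLE CONSTANTS ARE A PROVED ALGORITHM; THEOREMS-R1 Theorem E5, bookkeeping
half — every pair of operand formats `X, Y` and every destination `R`): the COMPUTABLE constants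
`envconstMulNE / envconstMulTZ / envconstMulDir X Y R` of `PatternEnvelopeMul.lean` — maxima of
the closed-form significand-pattern error over the realisable-and-placeable product patterns, no
operand enumeration (`code/enum/envconst.py` as a Lean function) — are SOUND: on the normal range
`2^m·q_R ≤ |a·b| ≤ maxRat_R` every product of data has relative error at most the constant of its
rounding (nearest: `NE`; toward zero: `TZ`; round down AND round up: `Dir`); and SHARP: as soon as
one product of data lies in the normal range of `R`, each of the four columns realises its
constant. -/
def R1_EnvelopeConstantsMul (X Y R : Format) : Prop :=
  (∀ (a : MiniFloat X) (b : MiniFloat Y), 2 ^ R.manBits * R.quantum ≤ |a.toRat * b.toRat| →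
      |a.toRat * b.toRat| ≤ R.maxRat →
        |(roundNE R (a.toRat * b.toRat)).toRat - a.toRat * b.toRat|
            ≤ envconstMulNE X Y R * |a.toRat * b.toRat| ∧
          |(roundTowardZero R (a.toRat * b.toRat)).toRat - a.toRat * b.toRat|
            ≤ envconstMulTZ X Y R * |a.toRat * b.toRat| ∧
          |(roundDown R (a.toRat * b.toRat)).toRat - a.toRat * b.toRat|
            ≤ envconstMulDir X Y R * |a.toRat * b.toRat| ∧
          |(roundUp R (a.toRat * b.toRat)).toRat - a.toRat * b.toRat|
            ≤ envconstMulDir X Y R * |a.toRat * b.toRat|) ∧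
  ((∃ (a : MiniFloat X) (b : MiniFloat Y), 2 ^ R.manBits * R.quantum ≤ |a.toRat * b.toRat| ∧
      |a.toRat * b.toRat| ≤ R.maxRat) →
    (∃ (a : MiniFloat X) (b : MiniFloat Y), 2 ^ R.manBits * R.quantum ≤ |a.toRat * b.toRat| ∧
        |a.toRat * b.toRat| ≤ R.maxRat ∧ |(roundNE R (a.toRat * b.toRat)).toRat - a.toRat * b.toRat|
          = envconstMulNE X Y R * |a.toRat * b.toRat|) ∧
    (∃ (a : MiniFloat X) (b : MiniFloat Y), 2 ^ R.manBits * R.quantum ≤ |a.toRat * b.toRat| ∧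
        |a.toRat * b.toRat| ≤ R.maxRat ∧
          |(roundTowardZero R (a.toRat * b.toRat)).toRat - a.toRat * b.toRat|
            = envconstMulTZ X Y R * |a.toRat * b.toRat|) ∧
    (∃ (a : MiniFloat X) (b : MiniFloat Y), 2 ^ R.manBits * R.quantum ≤ |a.toRat * b.toRat| ∧
        |a.toRat * b.toRat| ≤ R.maxRat ∧
          |(roundDown R (a.toRat * b.toRat)).toRat - a.toRat * b.toRat|
            = envconstMulDir X Y R * |a.toRat * b.toRat|) ∧
    (∃ (a : MiniFloat X) (b : MiniFloat Y), 2 ^ R.manBits * R.quantum ≤ |a.toRat * b.toRat| ∧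
        |a.toRat * b.toRat| ≤ R.maxRat ∧
          |(roundUp R (a.toRat * b.toRat)).toRat - a.toRat * b.toRat|
            = envconstMulDir X Y R * |a.toRat * b.toRat|))

/-- R1 product-table constants: PROVED for every format triple (`PatternEnvelopeMulModes.lean`). -/
theorem R1_EnvelopeConstantsMul_holds (X Y R : Format) : R1_EnvelopeConstantsMul X Y R := by
  refine ⟨fun a b hlo hhi => ⟨mul_relNE_le_envconst R a b hlo hhi, mul_relTZ_le_envconst R a b hlo hhi,
    mul_relRD_le_envconst R a b hlo hhi, mul_relRU_le_envconst R a b hlo hhi⟩, ?_⟩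
  rintro ⟨a, b, hlo, hhi⟩
  exact ⟨mul_relNE_attained R (List.ne_nil_of_mem (mem_mulPatErrs_of_normal _ R a b hlo hhi)),
    mul_relTZ_attained R (List.ne_nil_of_mem (mem_mulPatErrs_of_normal _ R a b hlo hhi)),
    mul_relRD_attained R (List.ne_nil_of_mem (mem_mulPatErrs_of_normal _ R a b hlo hhi)),
    mul_relRU_attained R (List.ne_nil_of_mem (mem_mulPatErrs_of_normal _ R a b hlo hhi))⟩

/-- R1 (THE SUM-TABLE CONSTANTS ARE A PROVED ALGORITHM; every `X, Y, R`): the computable constants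
`envconstAddNE / envconstAddTZ / envconstAddDir X Y R` of `PatternEnvelopeAdd.lean` (maxima over
the realisable-and-placeable ALIGNED-SUM patterns) are sound on the normal range of `R` for the
four roundings of the sum tables, and sharp as soon as one sum of data lies in that range. -/
def R1_EnvelopeConstantsAdd (X Y R : Format) : Prop :=
  (∀ (a : MiniFloat X) (b : MiniFloat Y), 2 ^ R.manBits * R.quantum ≤ |a.toRat + b.toRat| →
      |a.toRat + b.toRat| ≤ R.maxRat →
        |(roundNE R (a.toRat + b.toRat)).toRat - (a.toRat + b.toRat)|
            ≤ envconstAddNE X Y R * |a.toRat + b.toRat| ∧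
          |(roundTowardZero R (a.toRat + b.toRat)).toRat - (a.toRat + b.toRat)|
            ≤ envconstAddTZ X Y R * |a.toRat + b.toRat| ∧
          |(roundDown R (a.toRat + b.toRat)).toRat - (a.toRat + b.toRat)|
            ≤ envconstAddDir X Y R * |a.toRat + b.toRat| ∧
          |(roundUp R (a.toRat + b.toRat)).toRat - (a.toRat + b.toRat)|
            ≤ envconstAddDir X Y R * |a.toRat + b.toRat|) ∧
  ((∃ (a : MiniFloat X) (b : MiniFloat Y), 2 ^ R.manBits * R.quantum ≤ |a.toRat + b.toRat| ∧
      |a.toRat + b.toRat| ≤ R.maxRat) →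
    (∃ (a : MiniFloat X) (b : MiniFloat Y), 2 ^ R.manBits * R.quantum ≤ |a.toRat + b.toRat| ∧
        |a.toRat + b.toRat| ≤ R.maxRat ∧
          |(roundNE R (a.toRat + b.toRat)).toRat - (a.toRat + b.toRat)|
            = envconstAddNE X Y R * |a.toRat + b.toRat|) ∧
    (∃ (a : MiniFloat X) (b : MiniFloat Y), 2 ^ R.manBits * R.quantum ≤ |a.toRat + b.toRat| ∧
        |a.toRat + b.toRat| ≤ R.maxRat ∧
          |(roundTowardZero R (a.toRat + b.toRat)).toRat - (a.toRat + b.toRat)|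
            = envconstAddTZ X Y R * |a.toRat + b.toRat|) ∧
    (∃ (a : MiniFloat X) (b : MiniFloat Y), 2 ^ R.manBits * R.quantum ≤ |a.toRat + b.toRat| ∧
        |a.toRat + b.toRat| ≤ R.maxRat ∧
          |(roundDown R (a.toRat + b.toRat)).toRat - (a.toRat + b.toRat)|
            = envconstAddDir X Y R * |a.toRat + b.toRat|) ∧
    (∃ (a : MiniFloat X) (b : MiniFloat Y), 2 ^ R.manBits * R.quantum ≤ |a.toRat + b.toRat| ∧
        |a.toRat + b.toRat| ≤ R.maxRat ∧
          |(roundUp R (a.toRat + b.toRat)).toRat - (a.toRat + b.toRat)|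
            = envconstAddDir X Y R * |a.toRat + b.toRat|))

/-- R1 sum-table constants: PROVED for every format triple (`PatternEnvelopeAddModes.lean`). -/
theorem R1_EnvelopeConstantsAdd_holds (X Y R : Format) : R1_EnvelopeConstantsAdd X Y R := by
  refine ⟨fun a b hlo hhi => ⟨add_relNE_le_envconst R a b hlo hhi, add_relTZ_le_envconst R a b hlo hhi,
    add_relRD_le_envconst R a b hlo hhi, add_relRU_le_envconst R a b hlo hhi⟩, ?_⟩
  rintro ⟨a, b, hlo, hhi⟩
  exact ⟨add_relNE_attained R (List.ne_nil_of_mem (mem_addPatErrs_of_normal _ R a b hlo hhi)),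
    add_relTZ_attained R (List.ne_nil_of_mem (mem_addPatErrs_of_normal _ R a b hlo hhi)),
    add_relRD_attained R (List.ne_nil_of_mem (mem_addPatErrs_of_normal _ R a b hlo hhi)),
    add_relRU_attained R (List.ne_nil_of_mem (mem_addPatErrs_of_normal _ R a b hlo hhi))⟩


/-- R1 (THE PER-BAND PRODUCT CONSTANTS ARE A PROVED ALGORITHM; THEOREMS-R1-BANDS Theorem E5′,
normal bands, relative columns — every `X, Y, R` and every band `β` of the normal range of `R`,
`2^(m+β)·q_R ≤ |t| < 2^(m+β+1)·q_R`, `|t| ≤ maxRat_R`): the computable band constants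
`envconstMulBandNE / TZ / Dir X Y R β` of `PatternBands.lean` (maxima of the closed-form pattern
error over the realisable product patterns placed in band `β`; `code/enum/bandconst.py` as a Lean
function) bound the error of every product of data in the band for the rounding of their column
(nearest; toward zero; round down AND round up), and each is attained in the band as soon as one
product of data lies there. -/
def R1_BandConstantsMul (X Y R : Format) (β : ℕ) : Prop :=
  (∀ (a : MiniFloat X) (b : MiniFloat Y), 2 ^ (R.manBits + β) * R.quantum ≤ |a.toRat * b.toRat| →
      |a.toRat * b.toRat| < 2 ^ (R.manBits + β + 1) * R.quantum → |a.toRat * b.toRat| ≤ R.maxRat →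
        |(roundNE R (a.toRat * b.toRat)).toRat - a.toRat * b.toRat|
            ≤ envconstMulBandNE X Y R β * |a.toRat * b.toRat| ∧
          |(roundTowardZero R (a.toRat * b.toRat)).toRat - a.toRat * b.toRat|
            ≤ envconstMulBandTZ X Y R β * |a.toRat * b.toRat| ∧
          |(roundDown R (a.toRat * b.toRat)).toRat - a.toRat * b.toRat|
            ≤ envconstMulBandDir X Y R β * |a.toRat * b.toRat| ∧
          |(roundUp R (a.toRat * b.toRat)).toRat - a.toRat * b.toRat|
            ≤ envconstMulBandDir X Y R β * |a.toRat * b.toRat|) ∧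
  ((∃ (a : MiniFloat X) (b : MiniFloat Y), 2 ^ (R.manBits + β) * R.quantum ≤ |a.toRat * b.toRat| ∧
      |a.toRat * b.toRat| < 2 ^ (R.manBits + β + 1) * R.quantum ∧ |a.toRat * b.toRat| ≤ R.maxRat) →
    ∀ p : (ℚ → MiniFloat R) × ℚ, p ∈ [(roundNE R, envconstMulBandNE X Y R β),
        (roundTowardZero R, envconstMulBandTZ X Y R β), (roundDown R, envconstMulBandDir X Y R β),
        (roundUp R, envconstMulBandDir X Y R β)] →
      ∃ (a : MiniFloat X) (b : MiniFloat Y), 2 ^ (R.manBits + β) * R.quantum ≤ |a.toRat * b.toRat| ∧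
        |a.toRat * b.toRat| < 2 ^ (R.manBits + β + 1) * R.quantum ∧ |a.toRat * b.toRat| ≤ R.maxRat ∧
        |(p.1 (a.toRat * b.toRat)).toRat - a.toRat * b.toRat| = p.2 * |a.toRat * b.toRat|)

/-- R1 per-band product constants: PROVED for every format triple and band (`PatternBands.lean`:
`MiniFloat.mul_band_le`, `mul_band_attained` at the bridges `bridgeNE/TZ/RD/RU`). -/
theorem R1_BandConstantsMul_holds (X Y R : Format) (β : ℕ) : R1_BandConstantsMul X Y R β := by
  refine ⟨fun a b h1 h2 h3 => ⟨mul_band_le R (bridgeNE R _) β a b h1 h2 h3,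
    mul_band_le R (bridgeTZ R _) β a b h1 h2 h3, mul_band_le R (bridgeRD R _) β a b h1 h2 h3,
    mul_band_le R (bridgeRU R _) β a b h1 h2 h3⟩, ?_⟩
  rintro ⟨a, b, h1, h2, h3⟩ p hp
  simp only [List.mem_cons, List.not_mem_nil, or_false] at hp
  rcases hp with rfl | rfl | rfl | rfl
  · exact mul_band_attained R (bridgeNE R _) β
      (List.ne_nil_of_mem (mem_mulBandErrs_of_band _ R a b h1 h2 h3))
  · exact mul_band_attained R (bridgeTZ R _) β
      (List.ne_nil_of_mem (mem_mulBandErrs_of_band _ R a b h1 h2 h3))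
  · exact mul_band_attained R (bridgeRD R _) β
      (List.ne_nil_of_mem (mem_mulBandErrs_of_band _ R a b h1 h2 h3))
  · exact mul_band_attained R (bridgeRU R _) β
      (List.ne_nil_of_mem (mem_mulBandErrs_of_band _ R a b h1 h2 h3))

/-- R1 (THE PER-BAND SUM CONSTANTS ARE A PROVED ALGORITHM; every `X, Y, R, β`): the band constants
`envconstAddBandNE / TZ / Dir X Y R β` of `PatternBands.lean` bound the error of every sum of data
in band `β` of the normal range of `R` for the rounding of their column, and each is attained in
the band as soon as one sum of data lies there. -/
def R1_BandConstantsAdd (X Y R : Format) (β : ℕ) : Prop :=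
  (∀ (a : MiniFloat X) (b : MiniFloat Y), 2 ^ (R.manBits + β) * R.quantum ≤ |a.toRat + b.toRat| →
      |a.toRat + b.toRat| < 2 ^ (R.manBits + β + 1) * R.quantum → |a.toRat + b.toRat| ≤ R.maxRat →
        |(roundNE R (a.toRat + b.toRat)).toRat - (a.toRat + b.toRat)|
            ≤ envconstAddBandNE X Y R β * |a.toRat + b.toRat| ∧
          |(roundTowardZero R (a.toRat + b.toRat)).toRat - (a.toRat + b.toRat)|
            ≤ envconstAddBandTZ X Y R β * |a.toRat + b.toRat| ∧
          |(roundDown R (a.toRat + b.toRat)).toRat - (a.toRat + b.toRat)|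
            ≤ envconstAddBandDir X Y R β * |a.toRat + b.toRat| ∧
          |(roundUp R (a.toRat + b.toRat)).toRat - (a.toRat + b.toRat)|
            ≤ envconstAddBandDir X Y R β * |a.toRat + b.toRat|) ∧
  ((∃ (a : MiniFloat X) (b : MiniFloat Y), 2 ^ (R.manBits + β) * R.quantum ≤ |a.toRat + b.toRat| ∧
      |a.toRat + b.toRat| < 2 ^ (R.manBits + β + 1) * R.quantum ∧ |a.toRat + b.toRat| ≤ R.maxRat) →
    ∀ p : (ℚ → MiniFloat R) × ℚ, p ∈ [(roundNE R, envconstAddBandNE X Y R β),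
        (roundTowardZero R, envconstAddBandTZ X Y R β), (roundDown R, envconstAddBandDir X Y R β),
        (roundUp R, envconstAddBandDir X Y R β)] →
      ∃ (a : MiniFloat X) (b : MiniFloat Y), 2 ^ (R.manBits + β) * R.quantum ≤ |a.toRat + b.toRat| ∧
        |a.toRat + b.toRat| < 2 ^ (R.manBits + β + 1) * R.quantum ∧ |a.toRat + b.toRat| ≤ R.maxRat ∧
        |(p.1 (a.toRat + b.toRat)).toRat - (a.toRat + b.toRat)| = p.2 * |a.toRat + b.toRat|)

/-- R1 per-band sum constants: PROVED for every format triple and band (`PatternBands.lean`: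
`MiniFloat.add_band_le`, `add_band_attained`). -/
theorem R1_BandConstantsAdd_holds (X Y R : Format) (β : ℕ) : R1_BandConstantsAdd X Y R β := by
  refine ⟨fun a b h1 h2 h3 => ⟨add_band_le R (bridgeNE R _) β a b h1 h2 h3,
    add_band_le R (bridgeTZ R _) β a b h1 h2 h3, add_band_le R (bridgeRD R _) β a b h1 h2 h3,
    add_band_le R (bridgeRU R _) β a b h1 h2 h3⟩, ?_⟩
  rintro ⟨a, b, h1, h2, h3⟩ p hp
  simp only [List.mem_cons, List.not_mem_nil, or_false] at hp
  rcases hp with rfl | rfl | rfl | rfl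
  · exact add_band_attained R (bridgeNE R _) β
      (List.ne_nil_of_mem (mem_addBandErrs_of_band _ R a b h1 h2 h3))
  · exact add_band_attained R (bridgeTZ R _) β
      (List.ne_nil_of_mem (mem_addBandErrs_of_band _ R a b h1 h2 h3))
  · exact add_band_attained R (bridgeRD R _) β
      (List.ne_nil_of_mem (mem_addBandErrs_of_band _ R a b h1 h2 h3))
  · exact add_band_attained R (bridgeRU R _) β
      (List.ne_nil_of_mem (mem_addBandErrs_of_band _ R a b h1 h2 h3))

/-- R1 (THE PER-BAND TABLES IN ULPS AND ABSOLUTE UNITS ARE A PROVED ALGORITHM; THEOREMS-R1-BANDS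
Theorem E5′, normal bands, the `max ulp` and `max abs` columns — every `X, Y, R, β`, products): the
constants `envconstMulBandUlpNE / TZ / Dir X Y R β` of `PatternBandsUlp.lean` bound the error of
every product of data in band `β` in ulps of the band, `2^β · q_R` (so `c · 2^β · q_R` is the
absolute bound), for the rounding of their column, and each is attained in the band as soon as
one product of data lies there. -/
def R1_BandUlpConstantsMul (X Y R : Format) (β : ℕ) : Prop :=
  ∀ p : (ℚ → MiniFloat R) × ℚ, p ∈ [(roundNE R, envconstMulBandUlpNE X Y R β),
      (roundTowardZero R, envconstMulBandUlpTZ X Y R β), (roundDown R, envconstMulBandUlpDir X Y R β),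
      (roundUp R, envconstMulBandUlpDir X Y R β)] →
    (∀ (a : MiniFloat X) (b : MiniFloat Y), 2 ^ (R.manBits + β) * R.quantum ≤ |a.toRat * b.toRat| →
      |a.toRat * b.toRat| < 2 ^ (R.manBits + β + 1) * R.quantum → |a.toRat * b.toRat| ≤ R.maxRat →
        |(p.1 (a.toRat * b.toRat)).toRat - a.toRat * b.toRat| ≤ p.2 * (2 ^ β * R.quantum)) ∧
    ((∃ (a : MiniFloat X) (b : MiniFloat Y), 2 ^ (R.manBits + β) * R.quantum ≤ |a.toRat * b.toRat| ∧
      |a.toRat * b.toRat| < 2 ^ (R.manBits + β + 1) * R.quantum ∧ |a.toRat * b.toRat| ≤ R.maxRat) →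
      ∃ (a : MiniFloat X) (b : MiniFloat Y), 2 ^ (R.manBits + β) * R.quantum ≤ |a.toRat * b.toRat| ∧
        |a.toRat * b.toRat| < 2 ^ (R.manBits + β + 1) * R.quantum ∧ |a.toRat * b.toRat| ≤ R.maxRat ∧
        |(p.1 (a.toRat * b.toRat)).toRat - a.toRat * b.toRat| = p.2 * (2 ^ β * R.quantum))

/-- R1 per-band product tables in ulps: PROVED for every format triple and band
(`PatternBandsUlp.lean`: `MiniFloat.mul_bandUlp_le`, `mul_bandUlp_attained`). -/
theorem R1_BandUlpConstantsMul_holds (X Y R : Format) (β : ℕ) : R1_BandUlpConstantsMul X Y R β := by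
  intro p hp
  simp only [List.mem_cons, List.not_mem_nil, or_false] at hp
  have h0NE : ∀ N, N < 2 ^ R.manBits → (bridgeNE R (mulFuel X Y)).err R (mulFuel X Y) N = 0 :=
    fun _ h => patRelErrNE_eq_zero_of_lt h
  have h0TZ : ∀ N, N < 2 ^ R.manBits → (bridgeTZ R (mulFuel X Y)).err R (mulFuel X Y) N = 0 :=
    fun _ h => patRelErrTZ_eq_zero_of_lt h
  have h0RD : ∀ N, N < 2 ^ R.manBits → (bridgeRD R (mulFuel X Y)).err R (mulFuel X Y) N = 0 :=
    fun _ h => patRelErrDir_eq_zero_of_lt h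
  have h0RU : ∀ N, N < 2 ^ R.manBits → (bridgeRU R (mulFuel X Y)).err R (mulFuel X Y) N = 0 :=
    fun _ h => patRelErrDir_eq_zero_of_lt h
  rcases hp with rfl | rfl | rfl | rfl
  · exact ⟨fun a b h1 h2 h3 => mul_bandUlp_le R _ h0NE β a b h1 h2 h3, fun ⟨a, b, h1, h2, h3⟩ =>
      mul_bandUlp_attained R _ h0NE β
        (List.ne_nil_of_mem (mem_mulBandErrs_of_band _ R a b h1 h2 h3))⟩
  · exact ⟨fun a b h1 h2 h3 => mul_bandUlp_le R _ h0TZ β a b h1 h2 h3, fun ⟨a, b, h1, h2, h3⟩ =>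
      mul_bandUlp_attained R _ h0TZ β
        (List.ne_nil_of_mem (mem_mulBandErrs_of_band _ R a b h1 h2 h3))⟩
  · exact ⟨fun a b h1 h2 h3 => mul_bandUlp_le R _ h0RD β a b h1 h2 h3, fun ⟨a, b, h1, h2, h3⟩ =>
      mul_bandUlp_attained R _ h0RD β
        (List.ne_nil_of_mem (mem_mulBandErrs_of_band _ R a b h1 h2 h3))⟩
  · exact ⟨fun a b h1 h2 h3 => mul_bandUlp_le R _ h0RU β a b h1 h2 h3, fun ⟨a, b, h1, h2, h3⟩ =>
      mul_bandUlp_attained R _ h0RU β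
        (List.ne_nil_of_mem (mem_mulBandErrs_of_band _ R a b h1 h2 h3))⟩

/-- R1 (per-band tables in ulps and absolute units, sums; every `X, Y, R, β`): the constants
`envconstAddBandUlpNE / TZ / Dir X Y R β` bound the error of every sum of data in band `β` in ulps
of the band, and each is attained in the band as soon as one sum of data lies there. -/
def R1_BandUlpConstantsAdd (X Y R : Format) (β : ℕ) : Prop :=
  ∀ p : (ℚ → MiniFloat R) × ℚ, p ∈ [(roundNE R, envconstAddBandUlpNE X Y R β),
      (roundTowardZero R, envconstAddBandUlpTZ X Y R β), (roundDown R, envconstAddBandUlpDir X Y R β),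
      (roundUp R, envconstAddBandUlpDir X Y R β)] →
    (∀ (a : MiniFloat X) (b : MiniFloat Y), 2 ^ (R.manBits + β) * R.quantum ≤ |a.toRat + b.toRat| →
      |a.toRat + b.toRat| < 2 ^ (R.manBits + β + 1) * R.quantum → |a.toRat + b.toRat| ≤ R.maxRat →
        |(p.1 (a.toRat + b.toRat)).toRat - (a.toRat + b.toRat)| ≤ p.2 * (2 ^ β * R.quantum)) ∧
    ((∃ (a : MiniFloat X) (b : MiniFloat Y), 2 ^ (R.manBits + β) * R.quantum ≤ |a.toRat + b.toRat| ∧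
      |a.toRat + b.toRat| < 2 ^ (R.manBits + β + 1) * R.quantum ∧ |a.toRat + b.toRat| ≤ R.maxRat) →
      ∃ (a : MiniFloat X) (b : MiniFloat Y), 2 ^ (R.manBits + β) * R.quantum ≤ |a.toRat + b.toRat| ∧
        |a.toRat + b.toRat| < 2 ^ (R.manBits + β + 1) * R.quantum ∧ |a.toRat + b.toRat| ≤ R.maxRat ∧
        |(p.1 (a.toRat + b.toRat)).toRat - (a.toRat + b.toRat)| = p.2 * (2 ^ β * R.quantum))

/-- R1 per-band sum tables in ulps: PROVED for every format triple and band
(`PatternBandsUlp.lean`: `MiniFloat.add_bandUlp_le`, `add_bandUlp_attained`). -/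
theorem R1_BandUlpConstantsAdd_holds (X Y R : Format) (β : ℕ) : R1_BandUlpConstantsAdd X Y R β := by
  intro p hp
  simp only [List.mem_cons, List.not_mem_nil, or_false] at hp
  have h0NE : ∀ N, N < 2 ^ R.manBits → (bridgeNE R (addFuel X Y)).err R (addFuel X Y) N = 0 :=
    fun _ h => patRelErrNE_eq_zero_of_lt h
  have h0TZ : ∀ N, N < 2 ^ R.manBits → (bridgeTZ R (addFuel X Y)).err R (addFuel X Y) N = 0 :=
    fun _ h => patRelErrTZ_eq_zero_of_lt h
  have h0RD : ∀ N, N < 2 ^ R.manBits → (bridgeRD R (addFuel X Y)).err R (addFuel X Y) N = 0 :=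
    fun _ h => patRelErrDir_eq_zero_of_lt h
  have h0RU : ∀ N, N < 2 ^ R.manBits → (bridgeRU R (addFuel X Y)).err R (addFuel X Y) N = 0 :=
    fun _ h => patRelErrDir_eq_zero_of_lt h
  rcases hp with rfl | rfl | rfl | rfl
  · exact ⟨fun a b h1 h2 h3 => add_bandUlp_le R _ h0NE β a b h1 h2 h3, fun ⟨a, b, h1, h2, h3⟩ =>
      add_bandUlp_attained R _ h0NE β
        (List.ne_nil_of_mem (mem_addBandErrs_of_band _ R a b h1 h2 h3))⟩
  · exact ⟨fun a b h1 h2 h3 => add_bandUlp_le R _ h0TZ β a b h1 h2 h3, fun ⟨a, b, h1, h2, h3⟩ =>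
      add_bandUlp_attained R _ h0TZ β
        (List.ne_nil_of_mem (mem_addBandErrs_of_band _ R a b h1 h2 h3))⟩
  · exact ⟨fun a b h1 h2 h3 => add_bandUlp_le R _ h0RD β a b h1 h2 h3, fun ⟨a, b, h1, h2, h3⟩ =>
      add_bandUlp_attained R _ h0RD β
        (List.ne_nil_of_mem (mem_addBandErrs_of_band _ R a b h1 h2 h3))⟩
  · exact ⟨fun a b h1 h2 h3 => add_bandUlp_le R _ h0RU β a b h1 h2 h3, fun ⟨a, b, h1, h2, h3⟩ =>
      add_bandUlp_attained R _ h0RU β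
        (List.ne_nil_of_mem (mem_addBandErrs_of_band _ R a b h1 h2 h3))⟩

end Summit.Ventures.CertifiedArithmetic
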